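import Summits.Ventures.CertifiedManyBodySolver.Downfold.EmeryOrbitalWeightHarmonic
import HarnessLib

/-!
# The Cu weight of the antibonding band over an ENERGY SHELL: a kernel-evaluable Möbius–Taylor enclosure

Venture CertifiedManyBodySolver, cell `pub/hubbard-downfold` (stage S1; INFLATION-RULES-3to1-B §B.81 THE ORBITAL PARTITION OF THE
HOLES OVER THE ZONE), seat hubbard-downfold-mod-4 (technique B, g33); namespace `Summit.Ventures.CertifiedManyBodySolver.Downfold.Emery`.
Everything PROVED (0 sorry). WHAT THIS IS NOT: a statement about any material; `U = 0` one-body kinematics of the σ model.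

The harmonic law `EmeryOrbitalWeightHarmonic.dWeight_eq_harmonic` writes the Cu-d weight of a contour point as
`w(ε, s) = N(ε, s)/D(ε, s)` with `N = weightHarmN` AFFINE in the harmonic `s = (1 − cos k_x cos k_y)/2` and of degree 4 in `ε`, and
`D = fsN1·(α + 8β·s)` affine in `s`, degree 5 in `ε`. This file turns that into an ENCLOSURE device usable in a Brillouin-zone sum:

* §1 `Sext` — sextuples of coefficients (polynomials of degree ≤ 5), Horner `eval`, exact Taylor `shift` (`eval_shift`), and the
  tail bound `|p(t) − p₀| ≤ absTail p h` for `0 ≤ t ≤ h` (`abs_eval_sub_le_absTail`).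
* §2 the σ-model sextuples `sN0, sN1, sD0, sD1, sFsT, sFsN1` (closed-form coefficients in `(Δ, t_pd, t_pp, t_pp′)`, generic over a
  commutative ring so that the SAME definitions are evaluated in `ℚ` by the kernel and interpreted in `ℝ`): `N(ε, s) = sN0(ε) + s·sN1(ε)
  = weightHarmN` (`shellN_eq_weightHarmN`), `D(ε, s) = sD0(ε) + s·sD1(ε) = fsN1·(α + 8βs)` (`shellD_eq`), casts (`cast_shellN`, …).
* §3 (companion file `EmeryZoneWeightShellBound`): the shell enclosure `|w(e + t, s) − w(e, s)| ≤ shellDelta(e, h)` for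
  `0 ≤ t ≤ h`, `0 ≤ s ≤ 1`, and the Möbius monotonicity in `s`; this file carries the algebra (identities and casts) only.

Sources: three-band model [HybertsenSchluterChristensen1989, Eq. (1)]; `t, t′` contour language [AndersenEtAl1995, §6]; interval / Taylor
arithmetic [folklore] (R. E. Moore, Interval Analysis, 1966, Ch. 3).
-/

namespace Summit.Ventures.CertifiedManyBodySolver.Downfold.Emery

open Real Set

/-! ## §1 Sextuples: polynomials of degree ≤ 5 -/

/-- A polynomial of degree ≤ 5 by its coefficients `c0 + c1 t + … + c5 t⁵`. [folklore] -/
@[ext] structure Sext (R : Type*) where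
  /-- coefficient of `t⁰` -/
  c0 : R
  /-- coefficient of `t¹` -/
  c1 : R
  /-- coefficient of `t²` -/
  c2 : R
  /-- coefficient of `t³` -/
  c3 : R
  /-- coefficient of `t⁴` -/
  c4 : R
  /-- coefficient of `t⁵` -/
  c5 : R

namespace Sext

variable {R : Type*}

/-- Horner evaluation. [folklore] -/
def eval [CommRing R] (p : Sext R) (t : R) : R :=
  p.c0 + t * (p.c1 + t * (p.c2 + t * (p.c3 + t * (p.c4 + t * p.c5))))

/-- Exact Taylor shift: the coefficients of `t ↦ p(a + t)`. [folklore] -/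
def shift [CommRing R] (p : Sext R) (a : R) : Sext R where
  c0 := p.eval a
  c1 := p.c1 + 2 * a * p.c2 + 3 * a ^ 2 * p.c3 + 4 * a ^ 3 * p.c4 + 5 * a ^ 4 * p.c5
  c2 := p.c2 + 3 * a * p.c3 + 6 * a ^ 2 * p.c4 + 10 * a ^ 3 * p.c5
  c3 := p.c3 + 4 * a * p.c4 + 10 * a ^ 2 * p.c5
  c4 := p.c4 + 5 * a * p.c5
  c5 := p.c5

/-- `(p.shift a)(t) = p(a + t)`. [folklore] -/
theorem eval_shift [CommRing R] (p : Sext R) (a t : R) : (p.shift a).eval t = p.eval (a + t) := by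
  simp only [eval, shift]
  ring

/-- `(p.shift a).c0 = p(a)`. [folklore] -/
theorem shift_c0 [CommRing R] (p : Sext R) (a : R) : (p.shift a).c0 = p.eval a := rfl

/-- The tail bound `h·(|c1| + h·(|c2| + …))` = `Σ_{k ≥ 1} |c_k| h^k`. [folklore] -/
def absTail [CommRing R] [LinearOrder R] (p : Sext R) (h : R) : R :=
  h * (|p.c1| + h * (|p.c2| + h * (|p.c3| + h * (|p.c4| + h * |p.c5|))))

/-- For `0 ≤ t ≤ h`: `|p(t) − c0| ≤ absTail p h`. [folklore] -/
theorem abs_eval_sub_le_absTail (p : Sext ℝ) {t h : ℝ} (ht : 0 ≤ t) (hth : t ≤ h) :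
    |p.eval t - p.c0| ≤ p.absTail h := by
  have hh : 0 ≤ h := ht.trans hth
  simp only [eval, absTail]
  have e4 : |p.c4 + t * p.c5| ≤ |p.c4| + h * |p.c5| := by
    calc |p.c4 + t * p.c5| ≤ |p.c4| + |t * p.c5| := abs_add_le _ _
      _ = |p.c4| + t * |p.c5| := by rw [abs_mul, abs_of_nonneg ht]
      _ ≤ |p.c4| + h * |p.c5| := by gcongr
  have e3 : |p.c3 + t * (p.c4 + t * p.c5)| ≤ |p.c3| + h * (|p.c4| + h * |p.c5|) := by
    calc |p.c3 + t * (p.c4 + t * p.c5)| ≤ |p.c3| + |t * (p.c4 + t * p.c5)| := abs_add_le _ _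
      _ = |p.c3| + t * |p.c4 + t * p.c5| := by rw [abs_mul, abs_of_nonneg ht]
      _ ≤ |p.c3| + h * (|p.c4| + h * |p.c5|) := by gcongr
  have e2 : |p.c2 + t * (p.c3 + t * (p.c4 + t * p.c5))| ≤ |p.c2| + h * (|p.c3| + h * (|p.c4| + h * |p.c5|)) := by
    calc |p.c2 + t * (p.c3 + t * (p.c4 + t * p.c5))| ≤ |p.c2| + |t * (p.c3 + t * (p.c4 + t * p.c5))| := abs_add_le _ _
      _ = |p.c2| + t * |p.c3 + t * (p.c4 + t * p.c5)| := by rw [abs_mul, abs_of_nonneg ht]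
      _ ≤ |p.c2| + h * (|p.c3| + h * (|p.c4| + h * |p.c5|)) := by gcongr
  have e1 : |p.c1 + t * (p.c2 + t * (p.c3 + t * (p.c4 + t * p.c5)))| ≤
      |p.c1| + h * (|p.c2| + h * (|p.c3| + h * (|p.c4| + h * |p.c5|))) := by
    calc |p.c1 + t * (p.c2 + t * (p.c3 + t * (p.c4 + t * p.c5)))|
        ≤ |p.c1| + |t * (p.c2 + t * (p.c3 + t * (p.c4 + t * p.c5)))| := abs_add_le _ _
      _ = |p.c1| + t * |p.c2 + t * (p.c3 + t * (p.c4 + t * p.c5))| := by rw [abs_mul, abs_of_nonneg ht]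
      _ ≤ |p.c1| + h * (|p.c2| + h * (|p.c3| + h * (|p.c4| + h * |p.c5|))) := by gcongr
  have : p.c0 + t * (p.c1 + t * (p.c2 + t * (p.c3 + t * (p.c4 + t * p.c5)))) - p.c0 =
      t * (p.c1 + t * (p.c2 + t * (p.c3 + t * (p.c4 + t * p.c5)))) := by ring
  rw [this, abs_mul, abs_of_nonneg ht]
  calc t * |p.c1 + t * (p.c2 + t * (p.c3 + t * (p.c4 + t * p.c5)))|
      ≤ h * |p.c1 + t * (p.c2 + t * (p.c3 + t * (p.c4 + t * p.c5)))| := by gcongr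
    _ ≤ h * (|p.c1| + h * (|p.c2| + h * (|p.c3| + h * (|p.c4| + h * |p.c5|)))) := by gcongr

/-- `absTail` is non-negative for `h ≥ 0`. [folklore] -/
theorem absTail_nonneg (p : Sext ℝ) {h : ℝ} (hh : 0 ≤ h) : 0 ≤ p.absTail h := by
  unfold absTail; positivity

/-- `absTail` is monotone in the absolute values of the coefficients (`h ≥ 0`). [folklore] -/
theorem absTail_le_of_abs_le {p : Sext ℝ} {b1 b2 b3 b4 b5 h : ℝ} (hh : 0 ≤ h) (h1 : |p.c1| ≤ b1) (h2 : |p.c2| ≤ b2)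
    (h3 : |p.c3| ≤ b3) (h4 : |p.c4| ≤ b4) (h5 : |p.c5| ≤ b5) :
    p.absTail h ≤ h * (b1 + h * (b2 + h * (b3 + h * (b4 + h * b5)))) := by
  unfold absTail; gcongr

/-- Coefficientwise map. [folklore] -/
def map {S : Type*} (f : R → S) (p : Sext R) : Sext S := ⟨f p.c0, f p.c1, f p.c2, f p.c3, f p.c4, f p.c5⟩

/-- Cast `ℚ → ℝ` commutes with evaluation. [folklore] -/
theorem cast_eval (p : Sext ℚ) (t : ℚ) : ((p.eval t : ℚ) : ℝ) = (p.map (fun q : ℚ => (q : ℝ))).eval (t : ℝ) := by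
  simp only [eval, map]
  push_cast
  ring

/-- Cast `ℚ → ℝ` commutes with the Taylor shift. [folklore] -/
theorem map_shift (p : Sext ℚ) (a : ℚ) :
    (p.shift a).map (fun q : ℚ => (q : ℝ)) = (p.map (fun q : ℚ => (q : ℝ))).shift (a : ℝ) := by
  ext <;> simp only [shift, map, eval] <;> push_cast <;> ring

/-- Cast `ℚ → ℝ` commutes with `absTail`. [folklore] -/
theorem cast_absTail (p : Sext ℚ) (h : ℚ) :
    ((p.absTail h : ℚ) : ℝ) = (p.map (fun q : ℚ => (q : ℝ))).absTail (h : ℝ) := by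
  simp only [absTail, map]
  push_cast
  ring

end Sext

/-! ## §2 The σ-model sextuples (closed-form coefficients; generic over a commutative ring) -/

section Polys

variable {R : Type*} [CommRing R]

/-- Coefficients in `ε` of `N₀(ε) = 2t_pd²E·(2E·fsT + g·cA)` (`E = Δ + ε`, `g = t_pp + t_pp′`; `a = t_pd`, `b = t_pp`, `c = t_pp′`). [folklore] -/
def sN0 (Δ a b c : R) : Sext R where
  c0 := 16 * Δ ^ 2 * a ^ 4 * c + 16 * Δ ^ 2 * a ^ 4 * b + 4 * Δ ^ 3 * a ^ 4
  c1 := 32 * Δ * a ^ 4 * c + 32 * Δ * a ^ 4 * b - 8 * Δ ^ 2 * a ^ 2 * c ^ 2 + 8 * Δ ^ 2 * a ^ 2 * b ^ 2 + 12 * Δ ^ 2 * a ^ 4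
    - 2 * Δ ^ 3 * a ^ 2 * c + 2 * Δ ^ 3 * a ^ 2 * b
  c2 := 16 * a ^ 4 * c + 16 * a ^ 4 * b - 16 * Δ * a ^ 2 * c ^ 2 + 16 * Δ * a ^ 2 * b ^ 2 + 12 * Δ * a ^ 4
    - 6 * Δ ^ 2 * a ^ 2 * c + 6 * Δ ^ 2 * a ^ 2 * b
  c3 := -8 * a ^ 2 * c ^ 2 + 8 * a ^ 2 * b ^ 2 + 4 * a ^ 4 - 6 * Δ * a ^ 2 * c + 6 * Δ * a ^ 2 * b
  c4 := -2 * a ^ 2 * c + 2 * a ^ 2 * b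
  c5 := 0

/-- Coefficients in `ε` of `N₁(ε) = 2t_pd²E·8g·fsN`. [folklore] -/
def sN1 (Δ a b c : R) : Sext R where
  c0 := 32 * Δ * a ^ 4 * c ^ 2 + 64 * Δ * a ^ 4 * b * c + 32 * Δ * a ^ 4 * b ^ 2
  c1 := 32 * a ^ 4 * c ^ 2 + 64 * a ^ 4 * b * c + 32 * a ^ 4 * b ^ 2 - 16 * Δ * a ^ 2 * c ^ 3 - 16 * Δ * a ^ 2 * b * c ^ 2
    + 16 * Δ * a ^ 2 * b ^ 2 * c + 16 * Δ * a ^ 2 * b ^ 3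
  c2 := -16 * a ^ 2 * c ^ 3 - 16 * a ^ 2 * b * c ^ 2 + 16 * a ^ 2 * b ^ 2 * c + 16 * a ^ 2 * b ^ 3
  c3 := 0
  c4 := 0
  c5 := 0

/-- Coefficients in `ε` of `D₀(ε) = fsN1·α`. [folklore] -/
def sD0 (Δ a b c : R) : Sext R where
  c0 := 16 * Δ ^ 2 * a ^ 4 * c + 16 * Δ ^ 2 * a ^ 4 * b + 4 * Δ ^ 3 * a ^ 4
  c1 := 64 * Δ * a ^ 4 * c + 64 * Δ * a ^ 4 * b - 8 * Δ ^ 2 * a ^ 2 * c ^ 2 + 8 * Δ ^ 2 * a ^ 2 * b ^ 2 + 16 * Δ ^ 2 * a ^ 4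
    - 2 * Δ ^ 3 * a ^ 2 * c + 2 * Δ ^ 3 * a ^ 2 * b
  c2 := 48 * a ^ 4 * c + 48 * a ^ 4 * b - 48 * Δ * a ^ 2 * c ^ 2 + 48 * Δ * a ^ 2 * b ^ 2 + 20 * Δ * a ^ 4
    - 12 * Δ ^ 2 * a ^ 2 * c + 8 * Δ ^ 2 * a ^ 2 * b
  c3 := -40 * a ^ 2 * c ^ 2 + 40 * a ^ 2 * b ^ 2 + 8 * a ^ 4 + 8 * Δ * c ^ 3 - 8 * Δ * b * c ^ 2 - 8 * Δ * b ^ 2 * c + 8 * Δ * b ^ 3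
    - 18 * Δ * a ^ 2 * c + 10 * Δ * a ^ 2 * b + 2 * Δ ^ 2 * c ^ 2 - 2 * Δ ^ 2 * b * c
  c4 := 8 * c ^ 3 - 8 * b * c ^ 2 - 8 * b ^ 2 * c + 8 * b ^ 3 - 8 * a ^ 2 * c + 4 * a ^ 2 * b + 4 * Δ * c ^ 2 - 4 * Δ * b * c
  c5 := 2 * c ^ 2 - 2 * b * c

/-- Coefficients in `ε` of `D₁(ε) = 8·fsN1·β`. [folklore] -/
def sD1 (Δ a b c : R) : Sext R where
  c0 := -64 * a ^ 6 * c - 64 * a ^ 6 * b + 32 * Δ * a ^ 4 * c ^ 2 + 64 * Δ * a ^ 4 * b * c + 32 * Δ * a ^ 4 * b ^ 2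
  c1 := 160 * a ^ 4 * c ^ 2 + 128 * a ^ 4 * b * c - 32 * a ^ 4 * b ^ 2 - 16 * Δ * a ^ 2 * c ^ 3 - 16 * Δ * a ^ 2 * b * c ^ 2
    + 16 * Δ * a ^ 2 * b ^ 2 * c + 16 * Δ * a ^ 2 * b ^ 3
  c2 := -96 * a ^ 2 * c ^ 3 + 96 * a ^ 2 * b ^ 2 * c
  c3 := 16 * c ^ 4 - 16 * b * c ^ 3 - 16 * b ^ 2 * c ^ 2 + 16 * b ^ 3 * c
  c4 := 0
  c5 := 0

/-- Coefficients in `ε` of `fsT(ε)`. [folklore] -/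
def sFsT (Δ a b c : R) : Sext R where
  c0 := 4 * a ^ 2 * c + 4 * a ^ 2 * b + Δ * a ^ 2
  c1 := -2 * c ^ 2 + 2 * b ^ 2 + a ^ 2 - Δ * c
  c2 := -c
  c3 := 0
  c4 := 0
  c5 := 0

/-- The numerator `N(ε, s) = N₀(ε) + s·N₁(ε)`. [folklore] -/
def shellN (Δ a b c ε s : R) : R := (sN0 Δ a b c).eval ε + s * (sN1 Δ a b c).eval ε

/-- The denominator `D(ε, s) = D₀(ε) + s·D₁(ε)`. [folklore] -/
def shellD (Δ a b c ε s : R) : R := (sD0 Δ a b c).eval ε + s * (sD1 Δ a b c).eval ε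

end Polys

section Casts

/-- [folklore] -/
theorem map_sN0 (Δ a b c : ℚ) : (sN0 Δ a b c).map (fun q : ℚ => (q : ℝ)) = sN0 (Δ : ℝ) a b c := by
  ext <;> simp only [sN0, Sext.map] <;> push_cast <;> ring
/-- [folklore] -/
theorem map_sN1 (Δ a b c : ℚ) : (sN1 Δ a b c).map (fun q : ℚ => (q : ℝ)) = sN1 (Δ : ℝ) a b c := by
  ext <;> simp only [sN1, Sext.map] <;> push_cast <;> ring
/-- [folklore] -/
theorem map_sD0 (Δ a b c : ℚ) : (sD0 Δ a b c).map (fun q : ℚ => (q : ℝ)) = sD0 (Δ : ℝ) a b c := by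
  ext <;> simp only [sD0, Sext.map] <;> push_cast <;> ring
/-- [folklore] -/
theorem map_sD1 (Δ a b c : ℚ) : (sD1 Δ a b c).map (fun q : ℚ => (q : ℝ)) = sD1 (Δ : ℝ) a b c := by
  ext <;> simp only [sD1, Sext.map] <;> push_cast <;> ring
/-- [folklore] -/
theorem map_sFsT (Δ a b c : ℚ) : (sFsT Δ a b c).map (fun q : ℚ => (q : ℝ)) = sFsT (Δ : ℝ) a b c := by
  ext <;> simp only [sFsT, Sext.map] <;> push_cast <;> ring

end Casts

/-- `N(ε, s) = weightHarmN`. [folklore] -/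
theorem shellN_eq_weightHarmN (Δ a b c ε s : ℝ) : shellN Δ a b c ε s = weightHarmN Δ a b c ε s := by
  simp only [shellN, Sext.eval, sN0, sN1, weightHarmN, fsT, fsD, fsN, cA]
  ring

/-- `D(ε, s) = fsN1·(α + 8β·s)`. [folklore] -/
theorem shellD_eq (Δ a b c ε s : ℝ) :
    shellD Δ a b c ε s = fsN1 a b c ε * (scaleAlpha Δ a b c ε + 8 * scaleBeta Δ a b c ε * s) := by
  simp only [shellD, Sext.eval, sD0, sD1, fsN1, scaleAlpha, scaleBeta, dfsT, fsT, fsD, fsN, cA, dcA, dfsD, dfsN]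
  ring

/-- `sFsT(ε) = fsT(ε)`. [folklore] -/
theorem eval_sFsT (Δ a b c ε : ℝ) : (sFsT Δ a b c).eval ε = fsT Δ a b c ε := by
  simp only [Sext.eval, sFsT, fsT, fsD, fsN]
  ring

/-- Cast `ℚ → ℝ` commutes with `shellN`. [folklore] -/
theorem cast_shellN (Δ a b c ε s : ℚ) : ((shellN Δ a b c ε s : ℚ) : ℝ) = shellN (Δ : ℝ) a b c ε s := by
  simp only [shellN, Sext.eval, sN0, sN1]
  push_cast
  ring

/-- Cast `ℚ → ℝ` commutes with `shellD`. [folklore] -/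
theorem cast_shellD (Δ a b c ε s : ℚ) : ((shellD Δ a b c ε s : ℚ) : ℝ) = shellD (Δ : ℝ) a b c ε s := by
  simp only [shellD, Sext.eval, sD0, sD1]
  push_cast
  ring

end Summit.Ventures.CertifiedManyBodySolver.Downfold.Emery
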